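import Mathlib
import HarnessLib
import Summits.Ventures.LatticeQCDFlow.Scoring.ChainPathLaw
import Summits.Ventures.LatticeQCDFlow.Scoring.DoeblinThinning

/-!
# The thinned path law: every `k`-th state of the `κ`-chain IS the `κ^k`-chain — so the record-
# every-`k`-th-state certificates of `Scoring/DoeblinThinning.lean` hold for the simulated stream

HONEST FRAMING: exact (Metropolis-corrected) sampling algorithms for lattice gauge theory;
figures of merit are autocorrelation/cost numbers at stated couplings and volumes; no
continuum-physics claim.

Venture `LatticeQCDFlow` (cell pub-lqcd), topic `Scoring`; FANOUT row 8 (`s0-cpn-nemc`, GEN-15).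
NEW WORK of the cell, not a published result; no definition is introduced.
`Scoring/DoeblinThinning.lean` (and its SU(n)^E instance `Scoring/FlowSamplerParallel.lean`) proved
every any-start certificate of the row for the chain WITH KERNEL `nHit κ k = κ^k` and said so:
"the recorded-state sampler is MODELLED as the chain with kernel `nHit κ k`".  With the uniqueness
principle of `Scoring/ChainPathLaw.lean` (`eq_chain_of_tower`) and the iterated tower property
(`chain_tower_iterate`) the modelling step is now a theorem: the image of the Ionescu-Tulcea law
`P_{μ₀,κ}` under `x ↦ (n ↦ x (k n))` is `P_{μ₀,κ^k}`, for every `k` (for `k = 0` both sides are the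
constant chain).  Printed counterpart NAMED ONLY: the `m`-skeleton of a Markov chain is a Markov
chain with the `m`-step kernel (Meyn–Tweedie 1993, *Markov Chains and Stochastic Stability*,
§1.4.1 / Prop. 5.4.5 context; Revuz 1984 Ch. 1) — nothing is cited as a fact.

## Content (`κ` Markov, `P_{μ₀,κ} = Kernel.trajMeasure μ₀ (n ↦ κ ∘ (h ↦ h n))`; `ε_k = 1 − (1 − ε)^k`)

* **`chain_map_thin`** — THE THINNED PATH LAW: `P_{μ₀,κ}.map (x ↦ (n ↦ x (k n))) = P_{μ₀, nHit κ k}`;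
  **`chain_map_shift_thin`** — discard `s` updates, then record every `k`-th state:
  `P_{μ₀,κ}.map (x ↦ (n ↦ x (s + k n))) = P_{μ_s, nHit κ k}` with `μ_s` the time-`s` marginal;
* the certificates of `Scoring/DoeblinThinning.lean`, now for the stream `(X_{k i})_{i<m}` of the
  `κ`-CHAIN ITSELF (`π` invariant, `κ(x, ·) ≥ ε π`, `ε > 0`, `k ≥ 1`, `|f| ≤ C`, `C' = C + |πf|`):
  **`chain_thinned_mse_le_of_doeblin`** — from ANY start,
  `E_{μ₀}[((1/m) Σ_{i<m} f(X_{k i}) − πf)²] ≤ (2/ε_k − 1) Var_π f/m + 16 C'²/(ε_k² m²)`;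
  **`chain_thinned_confidence_of_doeblin`** — from ANY start, for `0 < η ≤ 1`,
  `P_{μ₀}(|(1/m) Σ_{i<m} f(X_{k i}) − πf| > 4C'/(ε_k m) + √(8 C'² log(2/η)/(ε_k² m))) ≤ η`;
  **`chain_thinned_variance_le_of_doeblin`** — started in `π`,
  `Var[(1/m) Σ_{i<m} f(X_{k i})] ≤ (2/ε_k − 1) Var_π f / m`;
  `chain_shift_thinned_mse_le_of_doeblin` — the same MSE bound for the stream `(X_{s + k i})_{i<m}`
  recorded after `s` discarded updates (any start; the bound does not see `s`, the burn-in GAIN is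
  `Scoring/ChainBurnInDiscard.lean`'s business).

Reading (value-free): "record every `k`-th state" needs no modelling any more — the recorded
stream of the simulated chain has exactly the law the kernel-level files computed with, from any
start and after any burn-in; a one-step certificate `ε` is worth `ε_k = 1 − (1 − ε)^k ≥ 1 − e^{−kε}`
per recorded sample in every bound of the row.  NOT CLAIMED: any `ε` for a concrete sampler; that
thinning beats the full-run estimator at equal updates (it does not — `Scoring/Thinning.lean`);
unbounded observables.
-/

noncomputable section

namespace Summit.Ventures.LatticeQCDFlow.Scoring

open MeasureTheory ProbabilityTheory Filter Finset Preorder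
open Summit.Ventures.LatticeQCDFlow.Exactness
open scoped ENNReal

variable {Ω : Type*} [MeasurableSpace Ω]

/-! ### The thinned path law -/

section PathLaw

variable (κ : Kernel Ω Ω) [IsMarkovKernel κ] (μ₀ : Measure Ω) [IsProbabilityMeasure μ₀]

/-- **THE THINNED PATH LAW.**  For every `k`, the image of the chain law `P_{μ₀,κ}` under
`x ↦ (n ↦ x (k n))` (keep every `k`-th state) is the chain law `P_{μ₀, κ^k}` of the `k`-step kernel
`nHit κ k` from the same start. -/
theorem chain_map_thin (k : ℕ) :
    haveI := isMarkovKernel_nHit κ k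
    (Kernel.trajMeasure (X := fun _ : ℕ => Ω) μ₀
        (fun n : ℕ => κ.comap (fun h : (i : ↥(Finset.Iic n)) → Ω => h ⟨n, Finset.mem_Iic.2 le_rfl⟩)
          (measurable_pi_apply _))).map (fun (x : ℕ → Ω) (n : ℕ) => x (k * n))
      = Kernel.trajMeasure (X := fun _ : ℕ => Ω) μ₀
        (fun n : ℕ => (nHit κ k).comap (fun h : (i : ↥(Finset.Iic n)) → Ω =>
          h ⟨n, Finset.mem_Iic.2 le_rfl⟩) (measurable_pi_apply _)) := by
  haveI := isMarkovKernel_nHit κ k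
  have hΘ : Measurable (fun (x : ℕ → Ω) (n : ℕ) => x (k * n)) :=
    measurable_pi_lambda _ fun n => measurable_pi_apply _
  haveI : IsProbabilityMeasure ((Kernel.trajMeasure (X := fun _ : ℕ => Ω) μ₀
      (fun n : ℕ => κ.comap (fun h : (i : ↥(Finset.Iic n)) → Ω => h ⟨n, Finset.mem_Iic.2 le_rfl⟩)
        (measurable_pi_apply _))).map (fun (x : ℕ → Ω) (n : ℕ) => x (k * n))) :=
    Measure.isProbabilityMeasure_map hΘ.aemeasurable
  refine eq_chain_of_tower (nHit κ k) μ₀ _ ?_ ?_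
  · rw [Measure.map_map (measurable_pi_apply 0) hΘ]
    exact chain_map_eval_zero κ μ₀
  · intro a F hF CF hCF g hg Cg hCg
    have hm1 : Measurable fun x : ℕ → Ω => F (frestrictLe a x) * g (x (a + 1)) :=
      (hF.comp (measurable_frestrictLe a)).mul (hg.comp (measurable_pi_apply _))
    have hm2 : Measurable fun x : ℕ → Ω => F (frestrictLe a x) * kop (nHit κ k) g (x a) :=
      (hF.comp (measurable_frestrictLe a)).mul
        ((measurable_kop (nHit κ k) hg).comp (measurable_pi_apply _))
    rw [integral_map hΘ.aemeasurable hm1.aestronglyMeasurable,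
      integral_map hΘ.aemeasurable hm2.aestronglyMeasurable]
    have hF' : Measurable fun h : (i : ↥(Finset.Iic (k * a))) → Ω =>
        F (fun i : ↥(Finset.Iic a) => h ⟨k * i, Finset.mem_Iic.2
          (Nat.mul_le_mul_left k (Finset.mem_Iic.1 i.2))⟩) :=
      hF.comp (measurable_pi_lambda _ fun i => measurable_pi_apply _)
    have key := chain_tower_iterate κ μ₀ (k * a)
      (F := fun h : (i : ↥(Finset.Iic (k * a))) → Ω =>
        F (fun i : ↥(Finset.Iic a) => h ⟨k * i, Finset.mem_Iic.2
          (Nat.mul_le_mul_left k (Finset.mem_Iic.1 i.2))⟩))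
      hF' (fun h => hCF _) k hg hCg
    rw [← kop_nHit κ k hg hCg] at key
    exact key

/-- **Discard `s` updates, then record every `k`-th state**: the image of `P_{μ₀,κ}` under
`x ↦ (n ↦ x (s + k n))` is the `κ^k`-chain started from the time-`s` marginal `μ_s`. -/
theorem chain_map_shift_thin (s k : ℕ) :
    haveI := isMarkovKernel_nHit κ k
    (Kernel.trajMeasure (X := fun _ : ℕ => Ω) μ₀
        (fun n : ℕ => κ.comap (fun h : (i : ↥(Finset.Iic n)) → Ω => h ⟨n, Finset.mem_Iic.2 le_rfl⟩)
          (measurable_pi_apply _))).map (fun (x : ℕ → Ω) (n : ℕ) => x (s + k * n))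
      = Kernel.trajMeasure (X := fun _ : ℕ => Ω)
        ((Kernel.trajMeasure (X := fun _ : ℕ => Ω) μ₀
          (fun n : ℕ => κ.comap (fun h : (i : ↥(Finset.Iic n)) → Ω => h ⟨n, Finset.mem_Iic.2 le_rfl⟩)
            (measurable_pi_apply _))).map (fun x : ℕ → Ω => x s))
        (fun n : ℕ => (nHit κ k).comap (fun h : (i : ↥(Finset.Iic n)) → Ω =>
          h ⟨n, Finset.mem_Iic.2 le_rfl⟩) (measurable_pi_apply _)) := by
  haveI := isMarkovKernel_nHit κ k
  haveI : IsProbabilityMeasure ((Kernel.trajMeasure (X := fun _ : ℕ => Ω) μ₀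
      (fun n : ℕ => κ.comap (fun h : (i : ↥(Finset.Iic n)) → Ω => h ⟨n, Finset.mem_Iic.2 le_rfl⟩)
        (measurable_pi_apply _))).map (fun x : ℕ → Ω => x s)) :=
    Measure.isProbabilityMeasure_map (measurable_pi_apply s).aemeasurable
  have hΘ : Measurable (fun (x : ℕ → Ω) (n : ℕ) => x (k * n)) :=
    measurable_pi_lambda _ fun n => measurable_pi_apply _
  have hS : Measurable (fun (x : ℕ → Ω) (n : ℕ) => x (s + n)) :=
    measurable_pi_lambda _ fun n => measurable_pi_apply _
  have hcomp : (fun (x : ℕ → Ω) (n : ℕ) => x (s + k * n))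
      = (fun (x : ℕ → Ω) (n : ℕ) => x (k * n)) ∘ (fun (x : ℕ → Ω) (n : ℕ) => x (s + n)) := rfl
  rw [hcomp, ← Measure.map_map hΘ hS, chain_map_shift κ μ₀ s]
  exact chain_map_thin κ _ k

end PathLaw

/-! ### The certificates of `Scoring/DoeblinThinning.lean` for the simulated stream -/

section Certificates

variable {κ : Kernel Ω Ω} [IsMarkovKernel κ] {μ₀ : Measure Ω} [IsProbabilityMeasure μ₀]
  {π : Measure Ω} [IsProbabilityMeasure π] {ε : ℝ≥0∞}

omit [IsMarkovKernel κ] [IsProbabilityMeasure μ₀] [IsProbabilityMeasure π] in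
/-- The squared error of a time average is a measurable functional of the path. -/
theorem measurable_sqError_timeAverage {f : Ω → ℝ} (hf : Measurable f) (m : ℕ) (c : ℝ) :
    Measurable fun y : ℕ → Ω => ((∑ i ∈ Finset.range m, f (y i)) / m - c) ^ 2 :=
  (((Finset.measurable_sum (Finset.range m) fun i _ => hf.comp (measurable_pi_apply i)).div_const
    _).sub_const _).pow_const 2

/-- **MEAN-SQUARE ERROR OF THE EVERY-`k`-TH-STATE AVERAGE OF THE `κ`-CHAIN, ANY START.**  With
`π` invariant, `κ(x, ·) ≥ ε π` (`ε > 0`), `k ≥ 1`, `|f| ≤ C`, `C' = C + |πf|`,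
`ε_k = 1 − (1 − ε)^k`: for the chain with kernel `κ` from ANY initial law and every `m ≥ 1`,
`E_{μ₀}[((1/m) Σ_{i<m} f(X_{k i}) − πf)²] ≤ (2/ε_k − 1) Var_π f / m + 16 C'²/(ε_k² m²)`. -/
theorem chain_thinned_mse_le_of_doeblin (hπ : Kernel.Invariant κ π)
    (hmin : ∀ x {B : Set Ω}, MeasurableSet B → ε * π B ≤ κ x B) (hε0 : 0 < ε) {k : ℕ} (hk : k ≠ 0)
    {f : Ω → ℝ} (hf : Measurable f) {C : ℝ} (hC : ∀ x, |f x| ≤ C) {m : ℕ} (hm : m ≠ 0) :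
    ∫ x, ((∑ i ∈ Finset.range m, f (x (k * i))) / m - ∫ z, f z ∂π) ^ 2
        ∂(Kernel.trajMeasure (X := fun _ : ℕ => Ω) μ₀
          (fun n : ℕ => κ.comap (fun h : (i : ↥(Finset.Iic n)) → Ω =>
            h ⟨n, Finset.mem_Iic.2 le_rfl⟩) (measurable_pi_apply _)))
      ≤ (2 / (1 - (1 - ε.toReal) ^ k) - 1) * (∫ z, (f z - ∫ y, f y ∂π) ^ 2 ∂π) / m
        + 16 * (C + |∫ z, f z ∂π|) ^ 2 / ((1 - (1 - ε.toReal) ^ k) ^ 2 * (m : ℝ) ^ 2) := by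
  haveI := isMarkovKernel_nHit κ k
  have hΘ : Measurable (fun (x : ℕ → Ω) (n : ℕ) => x (k * n)) :=
    measurable_pi_lambda _ fun n => measurable_pi_apply _
  have h := thinnedChain_mse_le_of_doeblin (μ₀ := μ₀) hπ hmin hε0 hk hf hC hm
  rw [← chain_map_thin κ μ₀ k, integral_map hΘ.aemeasurable
    (measurable_sqError_timeAverage hf m _).aestronglyMeasurable] at h
  exact h

/-- **CERTIFIED CONFIDENCE INTERVAL FOR THE EVERY-`k`-TH-STATE AVERAGE, ANY START.**  Same
hypotheses; for every `m ≥ 1` and `0 < η ≤ 1`: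
`P_{μ₀}(|(1/m) Σ_{i<m} f(X_{k i}) − πf| > 4C'/(ε_k m) + √(8 C'² log(2/η)/(ε_k² m))) ≤ η`. -/
theorem chain_thinned_confidence_of_doeblin (hπ : Kernel.Invariant κ π)
    (hmin : ∀ x {B : Set Ω}, MeasurableSet B → ε * π B ≤ κ x B) (hε0 : 0 < ε) {k : ℕ} (hk : k ≠ 0)
    {f : Ω → ℝ} (hf : Measurable f) {C : ℝ} (hC : ∀ x, |f x| ≤ C) {m : ℕ} (hm : m ≠ 0) {η : ℝ}
    (hη0 : 0 < η) (hη1 : η ≤ 1) :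
    (Kernel.trajMeasure (X := fun _ : ℕ => Ω) μ₀
          (fun n : ℕ => κ.comap (fun y : (i : ↥(Finset.Iic n)) → Ω =>
            y ⟨n, Finset.mem_Iic.2 le_rfl⟩) (measurable_pi_apply _))).real
        {x | 4 * (C + |∫ z, f z ∂π|) / ((1 - (1 - ε.toReal) ^ k) * m)
              + Real.sqrt (8 * (C + |∫ z, f z ∂π|) ^ 2 * Real.log (2 / η)
                  / ((1 - (1 - ε.toReal) ^ k) ^ 2 * m))
            < |(∑ i ∈ Finset.range m, f (x (k * i))) / m - ∫ z, f z ∂π|}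
      ≤ η := by
  haveI := isMarkovKernel_nHit κ k
  have hΘ : Measurable (fun (x : ℕ → Ω) (n : ℕ) => x (k * n)) :=
    measurable_pi_lambda _ fun n => measurable_pi_apply _
  have hA : MeasurableSet {y : ℕ → Ω | 4 * (C + |∫ z, f z ∂π|) / ((1 - (1 - ε.toReal) ^ k) * m)
        + Real.sqrt (8 * (C + |∫ z, f z ∂π|) ^ 2 * Real.log (2 / η)
            / ((1 - (1 - ε.toReal) ^ k) ^ 2 * m))
      < |(∑ i ∈ Finset.range m, f (y i)) / m - ∫ z, f z ∂π|} :=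
    measurableSet_lt measurable_const
      ((((Finset.measurable_sum (Finset.range m) fun i _ =>
        hf.comp (measurable_pi_apply i)).div_const _).sub_const _).abs)
  have h := thinnedChain_confidence_of_doeblin (μ₀ := μ₀) hπ hmin hε0 hk hf hC hm hη0 hη1
  rw [← chain_map_thin κ μ₀ k, map_measureReal_apply hΘ hA] at h
  exact h

/-- **VARIANCE OF THE EVERY-`k`-TH-STATE AVERAGE IN THE STATIONARY `κ`-CHAIN**: `π` invariant,
`κ(x, ·) ≥ ε π` (`ε > 0`), `k ≥ 1`, `f` bounded measurable, `m ≥ 1`: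
`Var_{P_π}[(1/m) Σ_{i<m} f(X_{k i})] ≤ (2/ε_k − 1) Var_π f / m`. -/
theorem chain_thinned_variance_le_of_doeblin (hπ : Kernel.Invariant κ π)
    (hmin : ∀ x {B : Set Ω}, MeasurableSet B → ε * π B ≤ κ x B) (hε0 : 0 < ε) {k : ℕ} (hk : k ≠ 0)
    {f : Ω → ℝ} (hf : Measurable f) {C : ℝ} (hC : ∀ x, |f x| ≤ C) {m : ℕ} (hm : m ≠ 0) :
    Var[fun x : ℕ → Ω => (∑ i ∈ Finset.range m, f (x (k * i))) / m;
        Kernel.trajMeasure (X := fun _ : ℕ => Ω) π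
          (fun n : ℕ => κ.comap (fun h : (i : ↥(Finset.Iic n)) → Ω => h ⟨n, Finset.mem_Iic.2 le_rfl⟩)
            (measurable_pi_apply _))]
      ≤ (2 / (1 - (1 - ε.toReal) ^ k) - 1) * (∫ z, (f z - ∫ y, f y ∂π) ^ 2 ∂π) / m := by
  haveI := isMarkovKernel_nHit κ k
  have hε1 := eps_le_one_of_doeblin hmin
  have hΘ : Measurable (fun (x : ℕ → Ω) (n : ℕ) => x (k * n)) :=
    measurable_pi_lambda _ fun n => measurable_pi_apply _
  have hG : Measurable fun y : ℕ → Ω => (∑ i ∈ Finset.range m, f (y i)) / m :=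
    (Finset.measurable_sum (Finset.range m) fun i _ => hf.comp (measurable_pi_apply i)).div_const _
  have h := variance_timeAverage_le_of_doeblin (κ := nHit κ k) (invariant_nHit hπ k)
    (doeblin_nHit_of_doeblin hπ hmin k) (eps_nHit_pos hε0 hk) hf hC hm
  rw [toReal_one_sub_pow ε hε1 k, autocov_zero, ← chain_map_thin κ π k,
    variance_map hG.aemeasurable hΘ.aemeasurable] at h
  exact h

/-- **Discard `s`, record every `k`-th: the same MSE bound**, for the stream `(X_{s + k i})_{i<m}`
of the `κ`-chain from any start (the bound is blind to `s`; the gain from `s` is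
`Scoring/ChainBurnInDiscard.lean`). -/
theorem chain_shift_thinned_mse_le_of_doeblin (hπ : Kernel.Invariant κ π)
    (hmin : ∀ x {B : Set Ω}, MeasurableSet B → ε * π B ≤ κ x B) (hε0 : 0 < ε) {k : ℕ} (hk : k ≠ 0)
    {f : Ω → ℝ} (hf : Measurable f) {C : ℝ} (hC : ∀ x, |f x| ≤ C) (s : ℕ) {m : ℕ} (hm : m ≠ 0) :
    ∫ x, ((∑ i ∈ Finset.range m, f (x (s + k * i))) / m - ∫ z, f z ∂π) ^ 2
        ∂(Kernel.trajMeasure (X := fun _ : ℕ => Ω) μ₀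
          (fun n : ℕ => κ.comap (fun h : (i : ↥(Finset.Iic n)) → Ω =>
            h ⟨n, Finset.mem_Iic.2 le_rfl⟩) (measurable_pi_apply _)))
      ≤ (2 / (1 - (1 - ε.toReal) ^ k) - 1) * (∫ z, (f z - ∫ y, f y ∂π) ^ 2 ∂π) / m
        + 16 * (C + |∫ z, f z ∂π|) ^ 2 / ((1 - (1 - ε.toReal) ^ k) ^ 2 * (m : ℝ) ^ 2) := by
  haveI := isMarkovKernel_nHit κ k
  haveI : IsProbabilityMeasure ((Kernel.trajMeasure (X := fun _ : ℕ => Ω) μ₀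
      (fun n : ℕ => κ.comap (fun h : (i : ↥(Finset.Iic n)) → Ω => h ⟨n, Finset.mem_Iic.2 le_rfl⟩)
        (measurable_pi_apply _))).map (fun x : ℕ → Ω => x s)) :=
    Measure.isProbabilityMeasure_map (measurable_pi_apply s).aemeasurable
  have hΘ : Measurable (fun (x : ℕ → Ω) (n : ℕ) => x (s + k * n)) :=
    measurable_pi_lambda _ fun n => measurable_pi_apply _
  have h := thinnedChain_mse_le_of_doeblin
    (μ₀ := (Kernel.trajMeasure (X := fun _ : ℕ => Ω) μ₀
      (fun n : ℕ => κ.comap (fun h : (i : ↥(Finset.Iic n)) → Ω => h ⟨n, Finset.mem_Iic.2 le_rfl⟩)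
        (measurable_pi_apply _))).map (fun x : ℕ → Ω => x s))
    hπ hmin hε0 hk hf hC hm
  rw [← chain_map_shift_thin κ μ₀ s k, integral_map hΘ.aemeasurable
    (measurable_sqError_timeAverage hf m _).aestronglyMeasurable] at h
  exact h

end Certificates

end Summit.Ventures.LatticeQCDFlow.Scoring

end
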